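import Summits.Parity.BatemanHorn.Theorems.SelbergDelangeRigidityLSDRealSegmentReconstructionFramework
import Summits.Parity.BatemanHorn.Theorems.SelbergDelangeRigidityLSDRealSegmentTailsFacts
import HarnessLib

/-!
# Route `SelbergDelangeRigidity`, crux `LSDRealSegment` (stmt-Parity-9770), line
# `product-anatomy-subcritical`: `P`-smooth parts (toolkit of `stub_tailsTwo`)

Elementary facts about the `P`-smooth / `P`-rough factorisation `m = smoothPart P m · roughPart P m` used by the
small-prime RESTORATION of `stub_tailsTwo` (slicing the values `fᵢ(n)` by their exact `P`-smooth parts):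
the factorisation of `smoothPart`, the characterisation `smoothPart P m = s ↔ s ∣ m ∧ ∀ p ≤ P, p^{v_p(s)+1} ∤ m`
(divisibility conditions by divisors of one modulus — hence periodic along polynomial values), `roughPart` of a
product, `y^{Ω(m)} ≤ m^{log₂ y}`, and the convergence of the smooth harmonic series `Σ_{s P-smooth} y^{Ω(s)}/s` for `y < 2` (`tailsTwo_smoothSeries`,
registered helper: bounded partial sums and small tails).
-/

open Filter Finset Polynomial
open scoped BigOperators Topology Classical

namespace Summit.Parity.BatemanHorn.Cruxes.LSDRealSegment.ProductAnatomySubcritical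

open Literature.NumberTheory.Sieve
open ArithmeticFunction (cardFactors)
noncomputable section

/-! ### Factorisation of the smooth and rough parts -/

/-- `smoothPart z m` is the product of `p^{v_p(m)}` over the primes `p ≤ z` of `m`. [folklore] -/
theorem smoothPart_eq_filter_prod (z : ℝ) (m : ℕ) :
    smoothPart z m = (m.factorization.filter fun p : ℕ => (p : ℝ) ≤ z).prod (· ^ ·) := by
  unfold smoothPart
  rw [Finsupp.prod_filter_index, Finsupp.support_filter, Finset.prod_filter]
  rfl

/-- `roughPart z m` is the product of `p^{v_p(m)}` over the primes `p > z` of `m`. [folklore] -/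
theorem roughPart_eq_filter_prod (z : ℝ) (m : ℕ) :
    roughPart z m = (m.factorization.filter fun p : ℕ => ¬ (p : ℝ) ≤ z).prod (· ^ ·) := by
  unfold roughPart
  rw [Finsupp.prod_filter_index, Finsupp.support_filter, Finset.prod_filter]
  refine Finset.prod_congr rfl fun p _ => ?_
  by_cases h : (p : ℝ) ≤ z <;> simp [h]

/-- The factorisation of the smooth part: `v_p(smoothPart z m) = v_p(m)` for `p ≤ z`, `0` otherwise. [folklore] -/
theorem factorization_smoothPart (z : ℝ) (m p : ℕ) :
    (smoothPart z m).factorization p = if (p : ℝ) ≤ z then m.factorization p else 0 := by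
  rw [smoothPart_eq_filter_prod, Nat.prod_pow_factorization_eq_self, Finsupp.filter_apply]
  intro q hq
  rw [Finsupp.support_filter, Finset.mem_filter] at hq
  exact Nat.prime_of_mem_primeFactors hq.1

/-- The factorisation of the rough part: `v_p(roughPart z m) = v_p(m)` for `p > z`, `0` otherwise. [folklore] -/
theorem factorization_roughPart (z : ℝ) (m p : ℕ) :
    (roughPart z m).factorization p = if (p : ℝ) ≤ z then 0 else m.factorization p := by
  rw [roughPart_eq_filter_prod, Nat.prod_pow_factorization_eq_self, Finsupp.filter_apply]
  · split_ifs <;> rfl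
  intro q hq
  rw [Finsupp.support_filter, Finset.mem_filter] at hq
  exact Nat.prime_of_mem_primeFactors hq.1

/-- The smooth part is never `0`. [folklore] -/
theorem smoothPart_ne_zero (z : ℝ) (m : ℕ) : smoothPart z m ≠ 0 := by
  rcases eq_or_ne m 0 with rfl | hm
  · simp
  exact fun h => hm (Nat.eq_zero_of_zero_dvd (h ▸ smoothPart_dvd z m))

/-- The rough part is never `0`. [folklore] -/
theorem roughPart_ne_zero (z : ℝ) (m : ℕ) : roughPart z m ≠ 0 := by
  rcases eq_or_ne m 0 with rfl | hm
  · simp [roughPart]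
  intro h
  have := smoothPart_mul_roughPart z hm
  rw [h, mul_zero] at this
  exact hm this.symm

/-- Every prime factor of the smooth part is `≤ z`. [folklore] -/
theorem le_of_mem_primeFactors_smoothPart {z : ℝ} {m p : ℕ} (hp : p ∈ (smoothPart z m).primeFactors) :
    (p : ℝ) ≤ z := by
  by_contra h
  have h1 : (smoothPart z m).factorization p = 0 := by rw [factorization_smoothPart, if_neg h]
  rw [← Nat.support_factorization, Finsupp.mem_support_iff] at hp
  exact hp h1

/-- Every prime factor of the rough part is `> z`. [folklore] -/
theorem lt_of_mem_primeFactors_roughPart {z : ℝ} {m p : ℕ} (hp : p ∈ (roughPart z m).primeFactors) :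
    z < (p : ℝ) := by
  by_contra h
  have h1 : (roughPart z m).factorization p = 0 := by rw [factorization_roughPart, if_pos (not_lt.mp h)]
  rw [← Nat.support_factorization, Finsupp.mem_support_iff] at hp
  exact hp h1

/-- The rough part as a quotient: `roughPart z m = m / smoothPart z m` (`m ≥ 1`). [folklore] -/
theorem roughPart_eq_div (z : ℝ) {m : ℕ} (hm : m ≠ 0) : roughPart z m = m / smoothPart z m := by
  exact (Nat.div_eq_of_eq_mul_right (Nat.pos_of_ne_zero (smoothPart_ne_zero z m))
    (smoothPart_mul_roughPart z hm).symm).symm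

/-- A number all of whose prime factors are `≤ z` is its own smooth part. [folklore] -/
theorem smoothPart_eq_self_of_le {z : ℝ} {m : ℕ} (hm : m ≠ 0) (h : ∀ p ∈ m.primeFactors, (p : ℝ) ≤ z) :
    smoothPart z m = m := by
  refine Nat.eq_of_factorization_eq (smoothPart_ne_zero z m) hm fun p => ?_
  rw [factorization_smoothPart]
  split_ifs with hpz
  · rfl
  · by_contra hne
    have : p ∈ m.primeFactors := by
      rw [← Nat.support_factorization, Finsupp.mem_support_iff]
      exact Ne.symm hne
    exact hpz (h p this)

/-- A number all of whose prime factors are `≤ z` has rough part `1`. [folklore] -/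
theorem roughPart_eq_one_of_le {z : ℝ} {m : ℕ} (hm : m ≠ 0) (h : ∀ p ∈ m.primeFactors, (p : ℝ) ≤ z) :
    roughPart z m = 1 := by
  have h1 := smoothPart_mul_roughPart z hm
  rw [smoothPart_eq_self_of_le hm h] at h1
  exact (mul_eq_left₀ hm).mp h1

/-- A number all of whose prime factors are `> z` is its own rough part. [folklore] -/
theorem roughPart_eq_self_of_lt {z : ℝ} {m : ℕ} (hm : m ≠ 0) (h : ∀ p ∈ m.primeFactors, z < (p : ℝ)) :
    roughPart z m = m := by
  refine Nat.eq_of_factorization_eq (roughPart_ne_zero z m) hm fun p => ?_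
  rw [factorization_roughPart]
  split_ifs with hpz
  · by_contra hne
    have : p ∈ m.primeFactors := by
      rw [← Nat.support_factorization, Finsupp.mem_support_iff]
      exact Ne.symm hne
    exact absurd (h p this) (not_lt.mpr hpz)
  · rfl

/-- The rough part is multiplicative on non-zero arguments (no coprimality needed). [folklore] -/
theorem roughPart_mul (z : ℝ) {m n : ℕ} (hm : m ≠ 0) (hn : n ≠ 0) :
    roughPart z (m * n) = roughPart z m * roughPart z n := by
  unfold roughPart
  rw [Nat.factorization_mul hm hn, Finsupp.prod_add_index']
  · intro p
    simp
  · intro p a b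
    split_ifs <;> simp [pow_add]

/-- Multiplying by a `z`-smooth number does not change the rough part. [folklore] -/
theorem roughPart_smooth_mul {z : ℝ} {s m : ℕ} (hs : s ≠ 0) (hsm : ∀ p ∈ s.primeFactors, (p : ℝ) ≤ z)
    (hm : m ≠ 0) : roughPart z (s * m) = roughPart z m := by
  rw [roughPart_mul z hs hm, roughPart_eq_one_of_le hs hsm, one_mul]

/-- The rough part is idempotent. [folklore] -/
theorem roughPart_roughPart (z : ℝ) (m : ℕ) : roughPart z (roughPart z m) = roughPart z m :=
  roughPart_eq_self_of_lt (roughPart_ne_zero z m) fun _ hp => lt_of_mem_primeFactors_roughPart hp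

/-- The tilt splits over the smooth/rough factorisation: `y^{Ω(m)} = y^{Ω(smooth)} y^{Ω(rough)}`. [folklore] -/
theorem pow_cardFactors_eq_smooth_mul_rough (y z : ℝ) {m : ℕ} (hm : m ≠ 0) :
    y ^ cardFactors m = y ^ cardFactors (smoothPart z m) * y ^ cardFactors (roughPart z m) := by
  conv_lhs => rw [← smoothPart_mul_roughPart z hm]
  rw [ArithmeticFunction.cardFactors_mul (smoothPart_ne_zero z m) (roughPart_ne_zero z m), pow_add]

/-! ### The exact smooth part as divisibility conditions -/

/-- **Characterisation of the exact smooth part**: for `m ≥ 1` and a `z`-smooth `s ≥ 1`,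
`smoothPart z m = s ↔ s ∣ m ∧ ∀ primes p ≤ z, p^{v_p(s)+1} ∤ m` — divisibility conditions only. [folklore] -/
theorem smoothPart_eq_iff {z : ℝ} {m s : ℕ} (hm : m ≠ 0) (hs : s ≠ 0) (hsm : ∀ p ∈ s.primeFactors, (p : ℝ) ≤ z) :
    smoothPart z m = s ↔ s ∣ m ∧ ∀ p : ℕ, p.Prime → (p : ℝ) ≤ z → ¬ p ^ (s.factorization p + 1) ∣ m := by
  constructor
  · rintro rfl
    refine ⟨smoothPart_dvd z m, fun p hp hpz hdvd => ?_⟩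
    have h1 := (hp.pow_dvd_iff_le_factorization hm).mp hdvd
    rw [factorization_smoothPart, if_pos hpz] at h1
    omega
  · rintro ⟨hdvd, hnot⟩
    refine Nat.eq_of_factorization_eq (smoothPart_ne_zero z m) hs fun p => ?_
    rw [factorization_smoothPart]
    by_cases hp : p.Prime
    · split_ifs with hpz
      · have h1 : s.factorization p ≤ m.factorization p := (Nat.factorization_le_iff_dvd hs hm).mpr hdvd p
        have h2 : ¬ s.factorization p + 1 ≤ m.factorization p := fun h =>
          hnot p hp hpz ((hp.pow_dvd_iff_le_factorization hm).mpr h)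
        omega
      · symm
        by_contra hne
        have : p ∈ s.primeFactors := by
          rw [← Nat.support_factorization, Finsupp.mem_support_iff]
          exact hne
        exact hpz (hsm p this)
    · simp [Nat.factorization_eq_zero_of_not_prime _ hp]

/-! ### Size of the tilt -/

/-- `y^{Ω(m)} ≤ m^{log₂ y}` for `y ≥ 1`, `m ≥ 1` (every prime is `≥ 2`). [folklore] -/
theorem pow_cardFactors_le_rpow {y : ℝ} (hy : 1 ≤ y) {m : ℕ} (hm : m ≠ 0) :
    y ^ cardFactors m ≤ (m : ℝ) ^ Real.logb 2 y := by
  have h2 : (2 : ℝ) ^ cardFactors m ≤ (m : ℝ) :=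
    pow_cardFactors_le_self zero_le_two hm fun q hq _ => by exact_mod_cast hq.two_le
  have hb : 0 ≤ Real.logb 2 y := Real.logb_nonneg one_lt_two hy
  have hy' : y = (2 : ℝ) ^ Real.logb 2 y := (Real.rpow_logb two_pos (by norm_num) (by linarith)).symm
  calc y ^ cardFactors m = ((2 : ℝ) ^ Real.logb 2 y) ^ cardFactors m := by rw [← hy']
    _ = ((2 : ℝ) ^ cardFactors m) ^ Real.logb 2 y := by
        rw [← Real.rpow_natCast, ← Real.rpow_natCast, ← Real.rpow_mul zero_le_two, mul_comm,
          Real.rpow_mul zero_le_two]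
    _ ≤ (m : ℝ) ^ Real.logb 2 y := Real.rpow_le_rpow (by positivity) h2 hb

/-! ### The smooth harmonic series -/

/-- **tailsTwo_smoothSeries** (registered helper of `stub_tailsTwo`, line `product-anatomy-subcritical`): for
`1 ≤ y < 2` the smooth harmonic series `Σ_{s P-smooth} y^{Ω(s)}/s = ∏_{p ≤ P} (1 − y/p)⁻¹` converges: its partial
sums are bounded and its tails are small (`y < 2 ≤ p`). [folklore] -/
theorem tailsTwo_smoothSeries : ∀ (y : ℝ) (P : ℕ), 1 ≤ y → y < 2 →
    (∃ K : ℝ, ∀ N : ℕ, (∑ m ∈ (Icc 1 N).filter (fun m : ℕ => ∀ p ∈ m.primeFactors, p ≤ P),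
      y ^ cardFactors m / m) ≤ K) ∧
    (∀ ε : ℝ, 0 < ε → ∃ T : ℕ, ∀ N : ℕ, (∑ m ∈ (Icc 1 N).filter
      (fun m : ℕ => (∀ p ∈ m.primeFactors, p ≤ P) ∧ T < m), y ^ cardFactors m / m) ≤ ε) := by
  intro y P hy hy2
  have hy0 : 0 ≤ y := by linarith
  -- the multiplicative weight `G(m) = y^{Ω(m)} 1[m is P-smooth]`
  set G : ℕ → ℝ := fun m => if ∀ p ∈ m.primeFactors, p ≤ P then y ^ cardFactors m else 0 with hG
  have hG0 : ∀ m, 0 ≤ G m := fun m => by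
    simp only [hG]
    split_ifs <;> positivity
  have hG1 : G 1 = 1 := by
    simp only [hG]
    rw [if_pos (fun p hp => by simp [Nat.primeFactors_one] at hp), ArithmeticFunction.cardFactors_one, pow_zero]
  have hGmul : ∀ m n : ℕ, m.Coprime n → G (m * n) = G m * G n := by
    intro m n hmn
    rcases eq_or_ne m 0 with rfl | hm
    · obtain rfl : n = 1 := by simpa using hmn
      simp [hG1]
    rcases eq_or_ne n 0 with rfl | hn
    · obtain rfl : m = 1 := by simpa using hmn
      simp [hG1]
    simp only [hG, Nat.primeFactors_mul hm hn, Finset.mem_union]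
    by_cases h1 : ∀ p ∈ m.primeFactors, p ≤ P
    · by_cases h2 : ∀ p ∈ n.primeFactors, p ≤ P
      · rw [if_pos (fun p hp => hp.elim (h1 p) (h2 p)), if_pos h1, if_pos h2,
          ArithmeticFunction.cardFactors_mul hm hn, pow_add]
      · rw [if_neg (fun h => h2 fun p hp => h p (Or.inr hp)), if_neg h2, mul_zero]
    · rw [if_neg (fun h => h1 fun p hp => h p (Or.inl hp)), if_neg h1, zero_mul]
  have hGpow : ∀ p : ℕ, p.Prime → ∀ ν : ℕ, G (p ^ ν) / (p : ℝ) ^ ν = if p ≤ P ∨ ν = 0 then (y / p) ^ ν else 0 := by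
    intro p hp ν
    simp only [hG]
    rcases Nat.eq_zero_or_pos ν with rfl | hν
    · simp
    · rw [Nat.primeFactors_prime_pow hν.ne' hp]
      simp only [Finset.mem_singleton, forall_eq, ArithmeticFunction.cardFactors_apply_prime_pow hp]
      by_cases hpP : p ≤ P
      · rw [if_pos hpP, if_pos (Or.inl hpP), div_pow]
      · rw [if_neg hpP, if_neg (by omega), zero_div]
  have hgeom : ∀ p : ℕ, p.Prime → 0 ≤ y / p ∧ y / p < 1 := by
    intro p hp
    have hp2 : (2 : ℝ) ≤ p := by exact_mod_cast hp.two_le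
    exact ⟨by positivity, by rw [div_lt_one (by linarith)]; linarith⟩
  have hsum : ∀ p : ℕ, p.Prime → Summable (fun ν : ℕ => G (p ^ ν) / (p : ℝ) ^ ν) := by
    intro p hp
    obtain ⟨h0, h1⟩ := hgeom p hp
    refine Summable.of_nonneg_of_le (fun ν => div_nonneg (hG0 _) (by positivity)) (fun ν => ?_)
      (summable_geometric_of_lt_one h0 h1)
    rw [hGpow p hp]
    split_ifs
    · exact le_rfl
    · positivity
  have htsum : ∀ p : ℕ, p.Prime → ∑' ν : ℕ, G (p ^ ν) / (p : ℝ) ^ ν ≤ (1 - y / p)⁻¹ := by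
    intro p hp
    obtain ⟨h0, h1⟩ := hgeom p hp
    rw [← tsum_geometric_of_lt_one h0 h1]
    refine (hsum p hp).tsum_le_tsum (fun ν => ?_) (summable_geometric_of_lt_one h0 h1)
    rw [hGpow p hp]
    split_ifs
    · exact le_rfl
    · positivity
  have htsum1 : ∀ p : ℕ, p.Prime → 1 ≤ ∑' ν : ℕ, G (p ^ ν) / (p : ℝ) ^ ν := by
    intro p hp
    rw [(hsum p hp).tsum_eq_zero_add]
    simp only [pow_zero, hG1, div_one, le_add_iff_nonneg_right]
    exact tsum_nonneg fun ν => div_nonneg (hG0 _) (by positivity)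
  set K : ℝ := ∏ p ∈ Nat.primesLE P, (1 - y / (p : ℝ))⁻¹ with hK
  have hpartial : ∀ N : ℕ, (∑ m ∈ (Icc 1 N).filter (fun m : ℕ => ∀ p ∈ m.primeFactors, p ≤ P),
      y ^ cardFactors m / m) ≤ K := by
    intro N
    have e : (∑ m ∈ (Icc 1 N).filter (fun m : ℕ => ∀ p ∈ m.primeFactors, p ≤ P), y ^ cardFactors m / m) =
        ∑ m ∈ Icc 1 N, G m / m := by
      rw [Finset.sum_filter]
      refine Finset.sum_congr rfl fun m _ => ?_
      simp only [hG]
      split_ifs <;> simp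
    rw [e]
    refine (Literature.NumberTheory.LFunctions.HallTenenbaum.sum_div_le_prod_tsum hG1 hGmul hG0 hsum N).trans ?_
    -- compare the Euler products prime by prime
    have hsplit : ∏ p ∈ Nat.primesLE N, ∑' ν : ℕ, G (p ^ ν) / (p : ℝ) ^ ν =
        (∏ p ∈ (Nat.primesLE N).filter (fun p => p ≤ P), ∑' ν : ℕ, G (p ^ ν) / (p : ℝ) ^ ν) *
          ∏ p ∈ (Nat.primesLE N).filter (fun p => ¬ p ≤ P), ∑' ν : ℕ, G (p ^ ν) / (p : ℝ) ^ ν :=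
      (Finset.prod_filter_mul_prod_filter_not _ _ _).symm
    have hbig : ∏ p ∈ (Nat.primesLE N).filter (fun p => ¬ p ≤ P), ∑' ν : ℕ, G (p ^ ν) / (p : ℝ) ^ ν = 1 := by
      refine Finset.prod_eq_one fun p hp => ?_
      rw [Finset.mem_filter] at hp
      have hp' := Nat.prime_of_mem_primesLE hp.1
      rw [(hsum p hp').tsum_eq_zero_add]
      simp only [pow_zero, hG1, div_one]
      rw [tsum_congr fun ν => by rw [hGpow p hp', if_neg (by push Not; exact ⟨by omega, by omega⟩)], tsum_zero,
        add_zero]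
    rw [hsplit, hbig, mul_one]
    have hsub : (Nat.primesLE N).filter (fun p => p ≤ P) ⊆ Nat.primesLE P := by
      intro p hp
      rw [Finset.mem_filter, Nat.mem_primesLE] at hp
      exact Nat.mem_primesLE.mpr ⟨hp.2, hp.1.2⟩
    calc ∏ p ∈ (Nat.primesLE N).filter (fun p => p ≤ P), ∑' ν : ℕ, G (p ^ ν) / (p : ℝ) ^ ν
        ≤ ∏ p ∈ Nat.primesLE P, ∑' ν : ℕ, G (p ^ ν) / (p : ℝ) ^ ν :=
          Finset.prod_le_prod_of_subset_of_one_le hsub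
            (fun p hp => le_trans zero_le_one (htsum1 p (Nat.prime_of_mem_primesLE (hsub hp))))
            fun p hp _ => htsum1 p (Nat.prime_of_mem_primesLE hp)
      _ ≤ K := Finset.prod_le_prod (fun p hp => le_trans zero_le_one (htsum1 p (Nat.prime_of_mem_primesLE hp)))
          fun p hp => htsum p (Nat.prime_of_mem_primesLE hp)
  refine ⟨⟨K, hpartial⟩, fun ε hε => ?_⟩
  -- tails: the partial sums are monotone and bounded, hence Cauchy
  set a : ℕ → ℝ := fun m => if (∀ p ∈ m.primeFactors, p ≤ P) ∧ 1 ≤ m then y ^ cardFactors m / m else 0 with ha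
  have ha0 : ∀ m, 0 ≤ a m := fun m => by
    simp only [ha]
    split_ifs <;> positivity
  have hrange : ∀ N : ℕ, ∑ m ∈ Finset.range N, a m ≤ K := by
    intro N
    refine le_trans ?_ (hpartial N)
    rw [Finset.sum_filter]
    have : ∑ m ∈ Finset.range N, a m ≤ ∑ m ∈ Finset.range (N + 1), a m :=
      Finset.sum_le_sum_of_subset_of_nonneg (Finset.range_subset_range.mpr (Nat.le_succ N)) fun m _ _ => ha0 m
    refine this.trans (le_of_eq ?_)
    rw [Finset.range_eq_Ico, ← Finset.sum_Ico_consecutive _ (Nat.zero_le 1) (by omega : 1 ≤ N + 1),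
      Finset.sum_Ico_eq_sum_range, show 1 - 0 = 1 from rfl, Finset.sum_range_one]
    simp only [ha, zero_add]
    rw [if_neg (by simp), zero_add, Finset.Ico_add_one_right_eq_Icc]
    refine Finset.sum_congr rfl fun m hm => ?_
    have hm1 : 1 ≤ m := (Finset.mem_Icc.mp hm).1
    by_cases h : ∀ p ∈ m.primeFactors, p ≤ P
    · rw [if_pos ⟨h, hm1⟩, if_pos h]
    · rw [if_neg (fun h' => h h'.1), if_neg h]
  have hsumm : Summable a := summable_of_sum_range_le ha0 hrange
  obtain ⟨s, hs⟩ := (summable_iff_vanishing_norm.mp hsumm) ε hε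
  refine ⟨s.sup id, fun N => ?_⟩
  have hdisj : Disjoint ((Icc 1 N).filter (fun m : ℕ => (∀ p ∈ m.primeFactors, p ≤ P) ∧ s.sup id < m)) s := by
    rw [Finset.disjoint_left]
    intro m hm hm'
    rw [Finset.mem_filter] at hm
    have : m ≤ s.sup id := Finset.le_sup (f := id) hm'
    omega
  have h := hs _ hdisj
  rw [Real.norm_eq_abs] at h
  have e : ∑ m ∈ (Icc 1 N).filter (fun m : ℕ => (∀ p ∈ m.primeFactors, p ≤ P) ∧ s.sup id < m),
      y ^ cardFactors m / m =
      ∑ m ∈ (Icc 1 N).filter (fun m : ℕ => (∀ p ∈ m.primeFactors, p ≤ P) ∧ s.sup id < m), a m := by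
    refine Finset.sum_congr rfl fun m hm => ?_
    rw [Finset.mem_filter, Finset.mem_Icc] at hm
    simp only [ha]
    rw [if_pos ⟨hm.2.1, hm.1.1⟩]
  rw [e]
  exact (le_abs_self _).trans h.le

end

end Summit.Parity.BatemanHorn.Cruxes.LSDRealSegment.ProductAnatomySubcritical
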